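import Mathlib
import Literature.MathematicalPhysics.QuantumFieldTheory.BalabanImbrieJaffe1984to88.BIJ85SigmaForm421
import Literature.MathematicalPhysics.QuantumFieldTheory.BalabanImbrieJaffe1984to88.BIJ85Prop521Proof

/-!
# `BalabanImbrieJaffe1984to88.BIJ85Sigma422Equivariance` — T. Bałaban, J. Imbrie, A. Jaffe, *Renormalization of the Higgs model:
minimizers, propagators and the stability of mean field theory*, Commun. Math. Phys. **97** (1985) 299–329
[BalabanImbrieJaffe1985]: Sect. 7.1 p. 321, *"Since we study periodic boundary conditions, σ_k is translation invariant"* —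
PROVED in the form: **every symmetry of the data of (4.1.1)/(4.2.2) is a symmetry of `G_{k,Ax}`, of the projection
`∂G_{k,Ax}∂^*` and of `σ_k = Q^e_k(I − ∂G_{k,Ax}∂^*)Q^{e*}_k`** (seat p09's `BIJ85AxialPropagator411.axialPropagator`,
`BIJ85SigmaForm421.curlG`, `BIJ85SigmaForm421.sigmaOp`)

statement-level skeleton of published theorems with citation tags; proofs where landed; nothing here is a claim about
the Yang–Mills mass gap

PDF held: `paper:balaban1985-cmp97-bij-higgs-minimizers` (journal page = PDF page + 298).  Text read: PDF pp. 12, 23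
(journal 310, 321).

CITATION HEADER (lean-in-tree rule).  Part of the lit-balaban TYPED SKELETON (HOME `run/shared/lean/pub/lit-balaban/`); WHAT IS
REPRODUCED: the translation-invariance sentence of SKELETON row **C1.Thm7.1.1** (p. 321 [PDF 23], verbatim: *"The strategy of
the proof is to give an explicit formula for σ_k, which we then analyze in detail. Since we study periodic boundary conditions,
σ_k is translation invariant. Thus it is natural to study σ_k as a multiplication operator σ_k(p) in the Fourier transform
representation."*) for the operator of row **C1.Eq4.2.1-4.2.2** ((4.2.2) p. 310 [PDF 12]: *"σ_k = Q^e_k(I − ∂G_{k,Ax}∂^*)Q^{e*}_k"*),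
`HOME/lit-balaban-r15/ROWS-C1.md` (owner r15, referee ref-5).  TYPED READING: the abstract setting of seat p09's
`BIJ85AxialPropagator411` §2 / `BIJ85SigmaForm421` (finite-dimensional real inner product spaces `E` (η-bond fields), `F`
(η-plaquette fields), `F′` (unit-lattice plaquette fields); constraint subspace `V ⊆ E` = support of `δ(Q_kA)δ_{k,Ax}(A)`; curl
`D : E → F`; `Qes = Q^{e*}_k : F′ → F`; `G_{k,Ax} = axialPropagator V D`, `∂G_{k,Ax}∂^* = curlG V D`, `σ_k = sigmaOp V D Qes`).  A
SYMMETRY OF THE DATA is a triple of linear isometric isomorphisms `U_E, U_F, U_{F′}` with `U_E V = V`, `D U_E = U_F D`,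
`Q^{e*}_k U_{F′} = U_F Q^{e*}_k` — on the torus with periodic boundary conditions the unit-lattice translations are such a triple.
WHAT IS KERNEL-CHECKED (zero `sorry`, standard axioms): `adjoint_intertwine` (adjoints of intertwined maps are intertwined);
**`axialPropagator_equivariant`** (`G_{k,Ax}U_E = U_E G_{k,Ax}`, from the Euler–Lagrange characterisation of `G_{k,Ax}J` in
`BIJ85Prop521Proof`, seats p30/p09), **`curlG_equivariant`**, **`sigmaOp_equivariant`** (`σ_k U_{F′} = U_{F′} σ_k`),
`inner_sigmaOp_equivariant` (`⟨U f, σ_k U g⟩ = ⟨f, σ_k g⟩`).  NOT CLAIMED: the verification that the unit-lattice translations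
of the torus model `BIJ85Sigma421Torus.sigmaTorus` (seat p30) preserve `V411` and intertwine `curlOp`, `QesOp` — the remaining
model-specific input for "σ_k is translation invariant" on T^{(k)}, hence for `BIJ85Eq712Plancherel.IsTranslInv`.
Unit `lit-balaban-p27` (gen 4).
-/

namespace Literature.MathematicalPhysics.QuantumFieldTheory.BalabanImbrieJaffe1984to88.BIJ85Sigma422Equivariance

open scoped RealInnerProductSpace
open BIJ85AxialPropagator411 BIJ85SigmaForm421 BIJ85Prop521Proof

noncomputable section

/-! ## §1 Isometric symmetries and adjoints -/

section Adjoint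

variable {X Y : Type*} [NormedAddCommGroup X] [InnerProductSpace ℝ X] [FiniteDimensional ℝ X]
  [NormedAddCommGroup Y] [InnerProductSpace ℝ Y] [FiniteDimensional ℝ Y]

omit [FiniteDimensional ℝ X] in
/-- kernel: `⟨U⁻¹a, b⟩ = ⟨a, Ub⟩`. [folklore] -/
private theorem inner_symm_left (U : X ≃ₗᵢ[ℝ] X) (a b : X) : ⟪U.symm a, b⟫ = ⟪a, U b⟫ := by
  rw [← U.inner_map_map (U.symm a) b, LinearIsometryEquiv.apply_symm_apply]

omit [FiniteDimensional ℝ X] in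
/-- kernel: `⟨a, U⁻¹b⟩ = ⟨Ua, b⟩`. [folklore] -/
private theorem inner_symm_right (U : X ≃ₗᵢ[ℝ] X) (a b : X) : ⟪a, U.symm b⟫ = ⟪U a, b⟫ := by
  rw [← U.inner_map_map a (U.symm b), LinearIsometryEquiv.apply_symm_apply]

omit [FiniteDimensional ℝ X] [FiniteDimensional ℝ Y] in
/-- kernel: an intertwining relation `A U_X = U_Y A` also intertwines the inverses. [folklore] -/
private theorem symm_intertwine (A : X →ₗ[ℝ] Y) (UX : X ≃ₗᵢ[ℝ] X) (UY : Y ≃ₗᵢ[ℝ] Y) (h : ∀ x, A (UX x) = UY (A x)) (x : X) :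
    A (UX.symm x) = UY.symm (A x) := by
  apply UY.injective
  rw [← h, LinearIsometryEquiv.apply_symm_apply, LinearIsometryEquiv.apply_symm_apply]

/-- **Adjoints of intertwined maps are intertwined**: `A U_X = U_Y A` with `U_X`, `U_Y` isometric isomorphisms ⇒
`A^* U_Y = U_X A^*` — so `Q^e_k = (Q^{e*}_k)^*` and `∂^*` inherit every symmetry of `Q^{e*}_k`, `∂` (the step of *"σ_k is
translation invariant"* for the adjoint factors of (4.2.2)). [cite: BalabanImbrieJaffe1985, Thm. 7.1.1 p.321] -/
theorem adjoint_intertwine (A : X →ₗ[ℝ] Y) (UX : X ≃ₗᵢ[ℝ] X) (UY : Y ≃ₗᵢ[ℝ] Y) (h : ∀ x, A (UX x) = UY (A x)) (y : Y) :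
    LinearMap.adjoint A (UY y) = UX (LinearMap.adjoint A y) := by
  refine ext_inner_left ℝ fun x => ?_
  rw [LinearMap.adjoint_inner_right, ← inner_symm_left UX, LinearMap.adjoint_inner_right, symm_intertwine A UX UY h,
    inner_symm_left]

end Adjoint

/-! ## §2 `G_{k,Ax}` is equivariant -/

section Propagator

variable {E F : Type*} [NormedAddCommGroup E] [InnerProductSpace ℝ E] [FiniteDimensional ℝ E]
  [NormedAddCommGroup F] [InnerProductSpace ℝ F] [FiniteDimensional ℝ F]

/-- **`G_{k,Ax}` is equivariant**: for isometric isomorphisms `U_E`, `U_F` with `U_E V = V` and `∂U_E = U_F∂`,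
`G_{k,Ax}(U_E J) = U_E(G_{k,Ax}J)` (*"σ_k is translation invariant"* at the level of the axial propagator of (4.1.1); by the
Euler–Lagrange characterisation `BIJ85Prop521Proof.inner_D_axialPropagator` / `eq_axialPropagator` of `G_{k,Ax}J` as the
minimizer of `½‖∂A‖² − ⟨A, J⟩` over `V`). [cite: BalabanImbrieJaffe1985, Thm. 7.1.1 p.321] -/
theorem axialPropagator_equivariant {V : Submodule ℝ E} {D : E →ₗ[ℝ] F} (hD : ∀ v : V, D (v : E) = 0 → v = 0)
    (UE : E ≃ₗᵢ[ℝ] E) (UF : F ≃ₗᵢ[ℝ] F) (hV : ∀ x ∈ V, UE x ∈ V) (hV' : ∀ x ∈ V, UE.symm x ∈ V)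
    (hDU : ∀ x, D (UE x) = UF (D x)) (J : E) :
    axialPropagator V D (UE J) = UE (axialPropagator V D J) := by
  have hmem : UE (axialPropagator V D J) ∈ V := hV _ (axialPropagator_mem V D J)
  symm
  refine eq_axialPropagator hD hmem fun w => ?_
  have hw : UE.symm (w : E) ∈ V := hV' _ w.2
  have h1 := inner_D_axialPropagator hD J ⟨UE.symm (w : E), hw⟩
  simp only at h1
  rw [hDU, ← inner_symm_right UF, ← symm_intertwine D UE UF hDU, h1, inner_symm_right]

end Propagator

/-! ## §3 `∂G_{k,Ax}∂^*` and `σ_k` are equivariant -/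

section Sigma

variable {E F F' : Type*} [NormedAddCommGroup E] [InnerProductSpace ℝ E] [FiniteDimensional ℝ E]
  [NormedAddCommGroup F] [InnerProductSpace ℝ F] [FiniteDimensional ℝ F]
  [NormedAddCommGroup F'] [InnerProductSpace ℝ F'] [FiniteDimensional ℝ F']

/-- **`∂G_{k,Ax}∂^*` is equivariant**: `(∂G_{k,Ax}∂^*)(U_F g) = U_F((∂G_{k,Ax}∂^*)g)`. [cite: BalabanImbrieJaffe1985, Thm. 7.1.1 p.321] -/
theorem curlG_equivariant {V : Submodule ℝ E} {D : E →ₗ[ℝ] F} (hD : ∀ v : V, D (v : E) = 0 → v = 0)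
    (UE : E ≃ₗᵢ[ℝ] E) (UF : F ≃ₗᵢ[ℝ] F) (hV : ∀ x ∈ V, UE x ∈ V) (hV' : ∀ x ∈ V, UE.symm x ∈ V)
    (hDU : ∀ x, D (UE x) = UF (D x)) (g : F) :
    curlG V D (UF g) = UF (curlG V D g) := by
  unfold curlG
  simp only [LinearMap.comp_apply]
  rw [adjoint_intertwine D UE UF hDU, axialPropagator_equivariant hD UE UF hV hV' hDU, hDU]

/-- **`σ_k = Q^e_k(I − ∂G_{k,Ax}∂^*)Q^{e*}_k` is equivariant**: a symmetry `(U_E, U_F, U_{F′})` of the data (`U_E V = V`,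
`∂U_E = U_F∂`, `Q^{e*}_kU_{F′} = U_FQ^{e*}_k`) commutes with `σ_k`: `σ_k(U_{F′}f) = U_{F′}(σ_k f)` — *"Since we study periodic
boundary conditions, σ_k is translation invariant."* [cite: BalabanImbrieJaffe1985, Thm. 7.1.1 p.321] -/
theorem sigmaOp_equivariant {V : Submodule ℝ E} {D : E →ₗ[ℝ] F} (hD : ∀ v : V, D (v : E) = 0 → v = 0) {Qes : F' →ₗ[ℝ] F}
    (UE : E ≃ₗᵢ[ℝ] E) (UF : F ≃ₗᵢ[ℝ] F) (UF' : F' ≃ₗᵢ[ℝ] F') (hV : ∀ x ∈ V, UE x ∈ V) (hV' : ∀ x ∈ V, UE.symm x ∈ V)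
    (hDU : ∀ x, D (UE x) = UF (D x)) (hQ : ∀ f, Qes (UF' f) = UF (Qes f)) (f : F') :
    sigmaOp V D Qes (UF' f) = UF' (sigmaOp V D Qes f) := by
  unfold sigmaOp
  simp only [LinearMap.comp_apply, LinearMap.sub_apply, LinearMap.id_apply]
  rw [hQ, curlG_equivariant hD UE UF hV hV' hDU, ← map_sub, adjoint_intertwine Qes UF' UF hQ]

/-- … hence the quadratic form is invariant: `⟨U f, σ_k U g⟩ = ⟨f, σ_k g⟩` (the printed "translation invariant").
[cite: BalabanImbrieJaffe1985, Thm. 7.1.1 p.321] -/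
theorem inner_sigmaOp_equivariant {V : Submodule ℝ E} {D : E →ₗ[ℝ] F} (hD : ∀ v : V, D (v : E) = 0 → v = 0)
    {Qes : F' →ₗ[ℝ] F} (UE : E ≃ₗᵢ[ℝ] E) (UF : F ≃ₗᵢ[ℝ] F) (UF' : F' ≃ₗᵢ[ℝ] F') (hV : ∀ x ∈ V, UE x ∈ V)
    (hV' : ∀ x ∈ V, UE.symm x ∈ V) (hDU : ∀ x, D (UE x) = UF (D x)) (hQ : ∀ f, Qes (UF' f) = UF (Qes f)) (f g : F') :
    ⟪UF' f, sigmaOp V D Qes (UF' g)⟫ = ⟪f, sigmaOp V D Qes g⟫ := by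
  rw [sigmaOp_equivariant hD UE UF UF' hV hV' hDU hQ, LinearIsometryEquiv.inner_map_map]

end Sigma

end

end Literature.MathematicalPhysics.QuantumFieldTheory.BalabanImbrieJaffe1984to88.BIJ85Sigma422Equivariance
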